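import Summits.CriticalPhenomena.PercolationContinuityZ3.Theses.PercQuarantineIslands
import Literature.Probability.Percolation.SiteConnectionTools
import Literature.Probability.Percolation.LatticeSymmetry
import Literature.Probability.Percolation.SharpnessDCTProofs
import Literature.Probability.Percolation.HalfSpacePinnedPairs
import Literature.Probability.Percolation.RSW
import HarnessLib

/-!
# `PercQuarantineIslands.TallPointCap` (stmt-CriticalPhenomena-7074), settled: the number of pairwise
# unjoined clusters of `B(2n)` joining `B(n)` to `∂⁻B(2n)` is capped by the tall points (first moment)

RSW3 lane (cell `prim-rsw3`, prover P2, gen 31).  Closes the support item AS FILED, for every `p`: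
`P_p(∃ A+1 points of B(n), each joined inside B(2n) to ∂⁻B(2n), pairwise not joined inside B(2n))
≤ 6(4n+1)² π_{H,p}(n-1)/(A+1)`, `π_{H,p}(n-1) = P_p(0 ↔ {x_0 = n-1} inside {x_0 ≥ 0})`.  Proof: a path inside
`B(2n)` from `B(n)` to a face point `y` (`y_j = ±2n`) enters the slab `{±x_j ≥ n+1} ∩ B(2n)` for the last time
at a TALL point `z` of the layer `{±x_j = n+1}` (joined inside that slab to the face), and `z` is joined to the
representative inside `B(2n)`; pairwise-unjoined representatives own distinct (face, tall point) pairs, so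
their number is at most the number `N` of such pairs; `E N ≤ 6(4n+1)² π_{H,p}(n-1)` (each tall event is
carried into the half-space arm event by a lattice automorphism; each layer has `(4n+1)²` points) and Markov's
inequality.  Nothing here uses p205010.
-/

noncomputable section

namespace Summit.CriticalPhenomena.PercolationContinuityZ3.Theorems.TallPoints

open MeasureTheory Literature.Probability.Percolation Literature.Probability.LatticeModels

/-! ## The tall event of a layer point is at most the half-space arm probability -/

/-- **A tall point is a translated, re-oriented half-space arm.**  For `z` on the layer `{z_j = σ(n+1)}`:
`P_p(∃ y, y_j = 2σn, z ↔ y inside {σ w_j ≥ n+1} ∩ B(2n)) ≤ P_p(∃ y, y_0 = n-1, 0 ↔ y inside {x_0 ≥ 0})`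
(`n ≥ 1`; the automorphism `w ↦ signedPerm (swap 0 j) ε (w - z)`, `ε_0 = σ`, sends `z` to `0`, the slab into
the half-space and the face `{w_j = 2σn}` onto `{x_0 = n-1}`). -/
theorem real_tall_le (p : unitInterval) {n : ℕ} (hn : 1 ≤ n) (j : Fin 3) (σ : ℤˣ) {z : Site 3}
    (hz : z j = (σ : ℤ) * ((n : ℤ) + 1)) :
    (bondPercolation (zdGraph 3) p).real
        {ω | ∃ y : Site 3, y j = (σ : ℤ) * (2 * (n : ℤ)) ∧
          ω ∈ openConnIn ({w : Site 3 | (n : ℤ) + 1 ≤ (σ : ℤ) * w j} ∩ ↑(box 3 (2 * n))) z y} ≤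
      (bondPercolation (zdGraph 3) p).real
        {ω | ∃ y : Site 3, y 0 = ((n - 1 : ℕ) : ℤ) ∧ ω ∈ openConnIn {x : Site 3 | 0 ≤ x 0} 0 y} := by
  classical
  set ε : Fin 3 → ℤˣ := Function.update 1 0 σ with hε
  set φ : zdGraph 3 ≃g zdGraph 3 := (zdShiftIso (-z)).trans (zdSignedPermIso (Equiv.swap 0 j) ε) with hφ
  have hφ0 : ∀ w : Site 3, φ w 0 = (σ : ℤ) * (w j - z j) := by
    intro w
    show (Site.signedPerm (Equiv.swap 0 j) ε (w + -z)) 0 = _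
    rw [Site.signedPerm_apply, hε, Function.update_self, Equiv.symm_swap, Equiv.swap_apply_left]
    simp [sub_eq_add_neg]
  have hφz : φ z = 0 := by
    show Site.signedPerm (Equiv.swap 0 j) ε (z + -z) = 0
    rw [add_neg_cancel]
    ext k; simp [Site.signedPerm_apply]
  have hσσ : (σ : ℤ) * σ = 1 := by rcases Int.units_eq_one_or σ with h | h <;> simp [h]
  -- the tall event is contained in the preimage of the half-space arm event
  have hsub : {ω | ∃ y : Site 3, y j = (σ : ℤ) * (2 * (n : ℤ)) ∧
        ω ∈ openConnIn ({w : Site 3 | (n : ℤ) + 1 ≤ (σ : ℤ) * w j} ∩ ↑(box 3 (2 * n))) z y} ⊆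
      BondConfig.relabel (sym2Equiv φ.toEquiv) ⁻¹'
        {ω | ∃ y : Site 3, y 0 = ((n - 1 : ℕ) : ℤ) ∧ ω ∈ openConnIn {x : Site 3 | 0 ≤ x 0} 0 y} := by
    rintro ω ⟨y, hy, hconn⟩
    refine ⟨φ y, ?_, ?_⟩
    · rw [hφ0, hy, hz]
      have : ((n - 1 : ℕ) : ℤ) = (n : ℤ) - 1 := by omega
      rw [this]
      calc (σ : ℤ) * ((σ : ℤ) * (2 * (n : ℤ)) - (σ : ℤ) * ((n : ℤ) + 1))
          = ((σ : ℤ) * σ) * ((n : ℤ) - 1) := by ring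
        _ = (n : ℤ) - 1 := by rw [hσσ, one_mul]
    · have h1 := relabel_mem_openConnIn φ.toEquiv hconn
      rw [RelIso.coe_fn_toEquiv, hφz] at h1
      refine openConnIn_mono ?_ _ _ h1
      rintro _ ⟨w, ⟨hw, -⟩, rfl⟩
      show 0 ≤ φ w 0
      rw [hφ0, hz]
      have : (σ : ℤ) * ((σ : ℤ) * w j) - (σ : ℤ) * ((σ : ℤ) * ((n : ℤ) + 1)) = w j * 0 + ((σ : ℤ) * σ) * w j - ((σ : ℤ) * σ) * ((n : ℤ) + 1) := by ring
      have hw' : (n : ℤ) + 1 ≤ (σ : ℤ) * w j := hw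
      nlinarith [hσσ]
  calc (bondPercolation (zdGraph 3) p).real _
      ≤ (bondPercolation (zdGraph 3) p).real (BondConfig.relabel (sym2Equiv φ.toEquiv) ⁻¹'
          {ω | ∃ y : Site 3, y 0 = ((n - 1 : ℕ) : ℤ) ∧ ω ∈ openConnIn {x : Site 3 | 0 ≤ x 0} 0 y}) :=
        measureReal_mono hsub
    _ = _ := bondPercolation_real_preimage_relabel_iso φ p _

/-! ## Tall points exist along every crossing -/

/-- **Last entrance into the final slab.**  On a lattice configuration, an open path inside `B(2n)` from
`x ∈ B(n)` to `y ∈ ∂⁻B(2n)` produces a face `(j, σ)` and a TALL point `a` of the layer `{a_j = σ(n+1)}` —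
joined inside the slab `{σ w_j ≥ n+1} ∩ B(2n)` to the face `{w_j = 2σn}` — which is joined to `x` inside
`B(2n)`. -/
theorem exists_tall_of_crossing {n : ℕ} (hn : 1 ≤ n) {ω : BondConfig (Site 3)} (hω : ω ⊆ (zdGraph 3).edgeSet)
    {x y : Site 3} (hx : x ∈ box 3 n) (hy : y ∈ innerBoundary (zdGraph 3) (box 3 (2 * n)))
    (hxy : ω ∈ openConnIn ↑(box 3 (2 * n)) x y) :
    ∃ (j : Fin 3) (σ : ℤˣ) (a : Site 3), a ∈ box 3 (2 * n) ∧ a j = (σ : ℤ) * ((n : ℤ) + 1) ∧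
      ω ∈ {ω | ∃ y' : Site 3, y' j = (σ : ℤ) * (2 * (n : ℤ)) ∧
        ω ∈ openConnIn ({w : Site 3 | (n : ℤ) + 1 ≤ (σ : ℤ) * w j} ∩ ↑(box 3 (2 * n))) a y'} ∧
      ω ∈ openConnIn ↑(box 3 (2 * n)) x a := by
  -- the face of `y`
  obtain ⟨j, hj⟩ := exists_eq_of_mem_innerBoundary_box hy
  have hyj : ∃ σ : ℤˣ, y j = (σ : ℤ) * (2 * (n : ℤ)) := by
    rcases hj with h | h
    · exact ⟨1, by rw [h]; simp⟩
    · exact ⟨-1, by rw [h]; simp⟩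
  obtain ⟨σ, hσ⟩ := hyj
  have hσ1 : (σ : ℤ) = 1 ∨ (σ : ℤ) = -1 := by rcases Int.units_eq_one_or σ with h | h <;> simp [h]
  -- the path, walked back from `y`, leaves the slab `R = {σ w_j ≥ n+1}` through the layer
  have hpath := (DCT16.mem_openConnIn_iff_pathIn.1 hxy).symm
  set R : Set (Site 3) := {w : Site 3 | (n : ℤ) + 1 ≤ (σ : ℤ) * w j} with hR
  have hyR : y ∈ R := by
    show (n : ℤ) + 1 ≤ (σ : ℤ) * y j
    rw [hσ]; rcases hσ1 with h | h <;> rw [h] <;> nlinarith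
  have hxR : x ∉ R := by
    intro h
    have h' : (n : ℤ) + 1 ≤ (σ : ℤ) * x j := h
    have hxj := (mem_box.1 hx) j
    rcases hσ1 with h1 | h1 <;> rw [h1] at h' <;> omega
  obtain ⟨a, b, haR, hbR, hbA, hab, hpa⟩ := hpath.exit hyR hxR
  have haR' : (n : ℤ) + 1 ≤ (σ : ℤ) * a j := haR
  have hbR' : ¬ (n : ℤ) + 1 ≤ (σ : ℤ) * b j := hbR
  -- `a` lies on the layer
  have hadj : (zdGraph 3).Adj a b := by
    have := hab
    rw [openGraph_adj] at this
    exact hω this.1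
  have hstep := zdGraph_adj_apply_le hadj j
  have haj : a j = (σ : ℤ) * ((n : ℤ) + 1) := by
    rcases hσ1 with h1 | h1 <;> rw [h1] at haR' hbR' ⊢ <;> omega
  have haA : a ∈ (↑(box 3 (2 * n)) : Set (Site 3)) := hpa.right_mem.2
  refine ⟨j, σ, a, Finset.mem_coe.1 haA, haj, ⟨y, hσ, ?_⟩, ?_⟩
  · -- `a ↔ y` inside the slab ∩ box
    exact DCT16.mem_openConnIn_iff_pathIn.2 hpa.symm
  · -- `x ↔ a` inside the box: `x ↔ y` and `y ↔ a`
    have h1 : ω ∈ openConnIn (↑(box 3 (2 * n)) : Set (Site 3)) y a :=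
      DCT16.mem_openConnIn_iff_pathIn.2 (hpa.mono Set.inter_subset_right)
    rw [DCT16.mem_openConnIn_iff_pathIn] at hxy h1 ⊢
    exact hxy.trans h1

/-! ## The cap -/

/-- A layer `{z ∈ B(2n) : z_j = c}` has at most `(4n+1)²` points (project on the other two coordinates). -/
theorem card_layer_le (n : ℕ) (j : Fin 3) (c : ℤ) :
    (((box 3 (2 * n)).filter fun z : Site 3 => z j = c).card : ℝ) ≤ (4 * (n : ℝ) + 1) ^ 2 := by
  classical
  have h : ((box 3 (2 * n)).filter fun z : Site 3 => z j = c).card ≤ (box 2 (2 * n)).card := by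
    refine Finset.card_le_card_of_injOn (fun z : Site 3 => fun k : Fin 2 => z (j.succAbove k)) ?_ ?_
    · intro z hz
      rw [Finset.mem_coe, Finset.mem_filter] at hz
      rw [Finset.mem_coe, mem_box]
      intro k
      exact (mem_box.1 hz.1) _
    · intro z hz z' hz' hzz
      rw [Finset.mem_coe, Finset.mem_filter] at hz hz'
      funext i
      by_cases hij : i = j
      · rw [hij, hz.2, hz'.2]
      · obtain ⟨k, hk⟩ := Fin.exists_succAbove_eq hij
        have := congrFun hzz k
        simp only [hk] at this
        exact this
  rw [card_box] at h
  have : ((2 * (2 * n) + 1 : ℕ) : ℝ) = 4 * (n : ℝ) + 1 := by push_cast; ring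
  calc (((box 3 (2 * n)).filter fun z : Site 3 => z j = c).card : ℝ) ≤ ((2 * (2 * n) + 1) ^ 2 : ℕ) := by
        exact_mod_cast h
    _ = (4 * (n : ℝ) + 1) ^ 2 := by push_cast; ring

/-- **`PercQuarantineIslands.TallPointCap` (stmt-CriticalPhenomena-7074), settled.** -/
theorem tallPointCap_proof :
    Summit.CriticalPhenomena.PercolationContinuityZ3.Theses.PercQuarantineIslands.TallPointCap := by
  classical
  intro p n A hn
  set μ := bondPercolation (zdGraph 3) p with hμ
  set πH : ℝ := μ.real {ω | ∃ y : Site 3, y 0 = ((n - 1 : ℕ) : ℤ) ∧ ω ∈ openConnIn {x : Site 3 | 0 ≤ x 0} 0 y}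
    with hπH
  -- the tall events, indexed by (face, point of the box)
  set T : (Fin 3 × ℤˣ) × Site 3 → Set (BondConfig (Site 3)) := fun q =>
    {ω | q.2 q.1.1 = (q.1.2 : ℤ) * ((n : ℤ) + 1) ∧ ∃ y' : Site 3, y' q.1.1 = (q.1.2 : ℤ) * (2 * (n : ℤ)) ∧
      ω ∈ openConnIn ({w : Site 3 | (n : ℤ) + 1 ≤ (q.1.2 : ℤ) * w q.1.1} ∩ ↑(box 3 (2 * n))) q.2 y'} with hT
  set I : Finset ((Fin 3 × ℤˣ) × Site 3) := (Finset.univ : Finset (Fin 3 × ℤˣ)) ×ˢ box 3 (2 * n) with hI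
  have hTm : ∀ q, MeasurableSet (T q) := by
    intro q
    by_cases hq : q.2 q.1.1 = (q.1.2 : ℤ) * ((n : ℤ) + 1)
    · have : T q = ⋃ y' ∈ {y' : Site 3 | y' q.1.1 = (q.1.2 : ℤ) * (2 * (n : ℤ))},
          openConnIn ({w : Site 3 | (n : ℤ) + 1 ≤ (q.1.2 : ℤ) * w q.1.1} ∩ ↑(box 3 (2 * n))) q.2 y' := by
        ext ω; simp [hT, hq]
      rw [this]
      exact MeasurableSet.biUnion (Set.to_countable _) fun y' _ => measurableSet_openConnIn_of_countable _ _ _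
    · have : T q = ∅ := by ext ω; simp [hT, hq]
      rw [this]; exact MeasurableSet.empty
  -- the counting variable `N = Σ_q 1_{T q}`
  set N : BondConfig (Site 3) → ℝ := fun ω => ∑ q ∈ I, (T q).indicator (fun _ => (1 : ℝ)) ω with hN
  have hNint : Integrable N μ :=
    integrable_finsetSum _ fun q _ => (integrable_const (1 : ℝ)).indicator (hTm q)
  have hNnonneg : 0 ≤ᵐ[μ] N := Filter.Eventually.of_forall fun ω =>
    Finset.sum_nonneg fun q _ => Set.indicator_nonneg (fun _ _ => zero_le_one) _
  -- E N ≤ 6 (4n+1)² πH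
  have hEN : ∫ ω, N ω ∂μ ≤ 6 * (4 * (n : ℝ) + 1) ^ 2 * πH := by
    rw [integral_finsetSum _ fun q _ => (integrable_const (1 : ℝ)).indicator (hTm q)]
    simp only [integral_indicator_const _ (hTm _), smul_eq_mul, mul_one]
    -- each term: 0 off the layer, ≤ πH on the layer
    have hterm : ∀ q ∈ I, μ.real (T q) ≤ if q.2 q.1.1 = (q.1.2 : ℤ) * ((n : ℤ) + 1) then πH else 0 := by
      intro q _
      split_ifs with hq
      · refine le_trans (measureReal_mono (fun ω hω => hω.2)) ?_
        exact real_tall_le p hn q.1.1 q.1.2 hq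
      · have : T q = ∅ := by ext ω; simp [hT, hq]
        rw [this, measureReal_empty]
    refine (Finset.sum_le_sum hterm).trans ?_
    rw [hI, Finset.sum_product]
    have hinner : ∀ f : Fin 3 × ℤˣ, (∑ z ∈ box 3 (2 * n),
        (if z f.1 = (f.2 : ℤ) * ((n : ℤ) + 1) then πH else 0)) ≤ (4 * (n : ℝ) + 1) ^ 2 * πH := by
      intro f
      rw [← Finset.sum_filter, Finset.sum_const, nsmul_eq_mul]
      exact mul_le_mul_of_nonneg_right (card_layer_le n f.1 _) measureReal_nonneg
    calc ∑ f : Fin 3 × ℤˣ, ∑ z ∈ box 3 (2 * n), (if z f.1 = (f.2 : ℤ) * ((n : ℤ) + 1) then πH else 0)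
        ≤ ∑ _f : Fin 3 × ℤˣ, (4 * (n : ℝ) + 1) ^ 2 * πH := Finset.sum_le_sum fun f _ => hinner f
      _ = 6 * (4 * (n : ℝ) + 1) ^ 2 * πH := by
          rw [Finset.sum_const, Finset.card_univ, Fintype.card_prod, Fintype.card_fin, Fintype.card_units_int,
            nsmul_eq_mul]; push_cast; ring
  -- the event is contained (a.s.) in `{A + 1 ≤ N}`
  have hincl : ∀ᵐ ω ∂μ, ω ∈ {ω | ∃ x : Fin (A + 1) → Site 3, (∀ i, x i ∈ box 3 n) ∧
      (∀ i, ∃ y ∈ innerBoundary (zdGraph 3) (box 3 (2 * n)), ω ∈ openConnIn ↑(box 3 (2 * n)) (x i) y) ∧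
      ∀ i j, i ≠ j → ω ∉ openConnIn ↑(box 3 (2 * n)) (x i) (x j)} → ω ∈ {ω | ((A : ℝ) + 1) ≤ N ω} := by
    filter_upwards [ae_subset_edgeSet (zdGraph 3) p] with ω hω hev
    obtain ⟨x, hxbox, hconn, hsep⟩ := hev
    -- choose a (face, tall point) for each representative
    have hchoice : ∀ i : Fin (A + 1), ∃ q ∈ I.filter (fun q => ω ∈ T q), ω ∈ openConnIn ↑(box 3 (2 * n)) (x i) q.2 := by
      intro i
      obtain ⟨y, hy, hxy⟩ := hconn i
      obtain ⟨j, σ, a, ha, haj, htall, hxa⟩ := exists_tall_of_crossing hn hω (hxbox i) hy hxy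
      refine ⟨((j, σ), a), ?_, hxa⟩
      rw [Finset.mem_filter, hI, Finset.mem_product]
      exact ⟨⟨Finset.mem_univ _, ha⟩, ⟨haj, htall⟩⟩
    choose g hg hxg using hchoice
    have hinj : Function.Injective g := by
      intro i i' hii'
      by_contra hne
      have h1 := hxg i
      have h2 := hxg i'
      rw [hii'] at h1
      apply hsep i i' hne
      rw [DCT16.mem_openConnIn_iff_pathIn] at h1 h2 ⊢
      exact h1.trans h2.symm
    -- hence the filter has at least `A + 1` elements, and `N ω` is its cardinality
    have hcard : A + 1 ≤ (I.filter (fun q => ω ∈ T q)).card := by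
      have := Finset.card_le_card_of_injOn (s := (Finset.univ : Finset (Fin (A + 1)))) g (fun i _ => hg i)
        (hinj.injOn)
      simpa using this
    have hNω : N ω = ((I.filter (fun q => ω ∈ T q)).card : ℝ) := by
      simp only [hN, Set.indicator_apply]
      rw [Finset.card_filter, Nat.cast_sum]
      refine Finset.sum_congr rfl fun q _ => ?_
      split_ifs <;> simp
    show ((A : ℝ) + 1) ≤ N ω
    rw [hNω]; exact_mod_cast hcard
  -- Markov
  have hmarkov := mul_meas_ge_le_integral_of_nonneg hNnonneg hNint ((A : ℝ) + 1)
  have hA0 : (0 : ℝ) < (A : ℝ) + 1 := by positivity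
  have hle : μ.real {ω | ∃ x : Fin (A + 1) → Site 3, (∀ i, x i ∈ box 3 n) ∧
      (∀ i, ∃ y ∈ innerBoundary (zdGraph 3) (box 3 (2 * n)), ω ∈ openConnIn ↑(box 3 (2 * n)) (x i) y) ∧
      ∀ i j, i ≠ j → ω ∉ openConnIn ↑(box 3 (2 * n)) (x i) (x j)} ≤ μ.real {ω | ((A : ℝ) + 1) ≤ N ω} :=
    ENNReal.toReal_mono (measure_ne_top _ _) (measure_mono_ae hincl)
  rw [le_div_iff₀ hA0]
  calc μ.real _ * ((A : ℝ) + 1) ≤ μ.real {ω | ((A : ℝ) + 1) ≤ N ω} * ((A : ℝ) + 1) :=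
        mul_le_mul_of_nonneg_right hle hA0.le
    _ = ((A : ℝ) + 1) * μ.real {ω | ((A : ℝ) + 1) ≤ N ω} := mul_comm _ _
    _ ≤ ∫ ω, N ω ∂μ := hmarkov
    _ ≤ 6 * (4 * (n : ℝ) + 1) ^ 2 * πH := hEN

end Summit.CriticalPhenomena.PercolationContinuityZ3.Theorems.TallPoints
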